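import Summits.QuantumFields.BalabanUV.T4Continuum.Support.NE7K1LinWalkFineOp

/-!
# NE7K1LinWalkRegion — row NE7 (node U5), candidate route HOM, path H1L, cell K1-lin(s): THE PRODUCT CUT-OFFS ON A GENERAL REGION —
# B4's standing hypothesis «Ω ⊂ ηℤ^d a union of big blocks (cubes of size M)» — NEUMANN COMPATIBILITY `|Δ_Ω h_j| = O(M⁻²)` AT EVERY
# SITE OF EVERY UNION OF BIG BLOCKS, WITHOUT ANY BOUNDARY ADAPTATION OF THE CUT-OFFS

Lineage `b2b-balaban-t4-ne7-p2` (CRUX PROVER NE7 #2), generation 70; series (RW) file 18, over `NE7K1LinWalkFineOp` (gen 68's instance on the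
ALIGNED BOX `Π_μ[0,(2K_μ+1)Mn)`).  [Balaban1983RegularityDecay] = T. Bałaban, *Regularity and decay of lattice Green's functions*, Commun.
Math. Phys. **89** (1983) 571–597: p. 572 «We consider operators on subsets of the lattice ηZ^d … Ω», the propagators `G_k(Ω, A)` (1.6) for
`Ω` a union of big blocks (the tree's `B4` module docstring: «Ω ⊂ T_η a union of big blocks (cubes of size M)»), and p. 575 the cut-offs
`h_j` of the cubes `□_j` with `|∂h_j| = O(M⁻¹)`, `|Δh_j| = O(M⁻²)`.

WHAT WAS OPEN (card `K1LIN-LINE.md` v1.11 §3m/§3n «NOT COVERED: general (non-aligned) regions»; HANDOFF § gen 69 (4)(c) «general block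
unions (corner ∕ re-entrant-edge cut-offs; M–L)»): gen 68's `NE7K1LinWalkCubes.abs_dirDiff_le` proves the Neumann second difference of the
product cut-off `cut W J = Π_μ Φ(x_μ∕W − 2J_μ + 1)` to be `≤ 32∕W²` at every site of the ALIGNED BOX only, using that the box's faces sit
where `Φ` is FLAT (`Phi_flat_int`).

THE LOCATED FACT (this file, §1): the profile `Φ = S − S(· − 2)` of `NE7K1LinWalkProfile` (`S` the `C¹` piecewise-quadratic step) is FLAT
TO SECOND ORDER AT EVERY INTEGER: for `j ∈ ℤ`, **`abs_Phi_int_add_sub_le`** `|Φ(j + h) − Φ(j)| ≤ 2h²` (`0 ≤ h ≤ 1`) and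
**`abs_Phi_int_sub_sub_le`** `|Φ(j − h) − Φ(j − 2h)| ≤ 8h²` (`0 ≤ 2h ≤ 1`) — four cases on `j ∈ {0,1,2,3}` with the explicit pieces
`S(t) ≤ 2t²` and `S(t) + S(1 − t) = 1` on `[0,1]`, zero elsewhere.  CONSEQUENCE (§§3–4): on ANY region `Ω` that is a union of `W`-cells
(`W = Mn` sites = one big block of side `M` in unit-lattice units) a site `x ∈ Ω` whose neighbour `x ± e_μ` is missing has `W ∣ x_μ`
resp. `W ∣ x_μ + 1` (`exists_mul_of_sub_uvec_not_mem` ∕ `exists_mul_of_add_uvec_not_mem`), so the REMAINING one-sided difference of every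
cut-off is `≤ 2∕W²` resp. `≤ 8∕W²` (`abs_cut_sub_cut_add_uvec_le` ∕ `abs_cut_sub_cut_sub_uvec_le`); with the interior second difference
`≤ 32∕W²` (`NE7K1LinWalkCubes.abs_cut_secondDiff_le`) this gives **`abs_dirDiff_le_region`**: the μ-directional NEUMANN second difference
on `Ω` is `≤ 32∕W²` at EVERY site of EVERY such `Ω`, and **`abs_sum_nbrs_cut_sub_le_region`**: `|Σ_{y ∼ x, y ∈ Ω}(cut x − cut y)| ≤ 32(d+1)∕W²`
— the hypothesis `hlap` of `NE7K1LinWalkCommutator.comm_mulVec_sq_le_fineOpR` with the SAME constant as on the box.  No parity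
condition on the cells, no corner or re-entrant-edge correction: B4's Neumann compatibility of the `h_j` at `∂Ω` holds for the unmodified
product cut-offs on every union of big blocks.

THE REGIONS (§2): `reg W K C = {x ∈ Π_μ[0,(2K_μ+1)W) : blk W x ∈ C}` for an ARBITRARY finite cell set `C ⊂ ℤ^{d+1}` inside the bounding
box of labels `K` (the bounding box is no restriction: `K` is arbitrary); `mem_reg`; `reg_isBlockUnion` (a union of `W`-blocks) and
`reg_isBlockUnion_fine` (hence of `n`-blocks when `W = Mn` — the hypothesis of `B4Lower18.lower18_zero`); **`reg_image_blk_eq`**: EVERY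
`R ⊆ Π_μ[0,(2K_μ+1)W)` that is a union of `W`-blocks IS `reg W K (R.image (blk W))` — the family is exactly «all unions of big blocks in the
bounding box»; `reg_box`: the aligned box itself is the region of all cells; `sum_cut_eq_one_region`: the partition of unity
`Σ_{J ∈ Π_μ{0..K_μ}} cut W J x = 1` on every region (from the box).

HONEST FRAMING: [folklore] piecewise-quadratic case analysis and integer division; nothing of Bałaban's asserted; no `sorry`.  Census only
(cell K1-lin(s)'s «template application», random-walk half: the cut-off system is region-ready; the instance on regions is file 19
`NE7K1LinWalkFineOpRegion`); NO letter ∕ tag ∕ size of NE7 moves; NE7 NOT PRINTED ∕ NOT PROVED; spine 0∕9; FIXED FINITE T⁴, rung (B)+1;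
NOT infinite volume, NOT mass gap, NOT Clay.  HONEST DEPENDENCY: continuum YM on T⁴ ⇐ BetaPertH ∧ nine spine estimates (0/9 proved);
BetaPertH ⇐ (D1) ∧ (D4) ∧ CAP+tail; G-an2-4 gates asym, D1 and NE2/3/4.
-/

noncomputable section

open Finset

namespace Summit.QuantumFields.BalabanUV.T4Continuum.NE7K1LinWalkRegion

open NE7K1LinWalkProfile NE7K1LinWalkCubes NE7K1LinWalkBox NE7K1LinWalkFineOp
open Literature.MathematicalPhysics.QuantumFieldTheory.Balaban1983to89
open Literature.MathematicalPhysics.QuantumFieldTheory.Balaban1983to89.B4Reflection242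
open Literature.MathematicalPhysics.QuantumFieldTheory.Balaban1983to89.B4BoxCov237
open Literature.MathematicalPhysics.QuantumFieldTheory.Balaban1983to89.B4Lower18

variable {d : ℕ}

/-! ### §1 The profile is flat to second order at every integer -/

/-- `S(t) ≤ 2t²` on `[0,1]` (equality on `[0,½]`; on `[½,1]` the defect is `−(1−2t)²`). [folklore] -/
theorem S_le_two_sq {t : ℝ} (h0 : 0 ≤ t) (h1 : t ≤ 1) : S t ≤ 2 * t ^ 2 := by
  rcases le_or_gt t (1 / 2) with h | h
  · rw [S_of_le_half h0 h]
  · rw [S_of_half_le h.le h1]; nlinarith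

/-- the step is symmetric: `S(t) + S(1 − t) = 1` on `[0,1]`. [folklore] -/
theorem S_add_S_one_sub {t : ℝ} (h0 : 0 ≤ t) (h1 : t ≤ 1) : S t + S (1 - t) = 1 := by
  rcases le_or_gt t (1 / 2) with h | h
  · rw [S_of_le_half h0 h, S_of_half_le (by linarith) (by linarith)]; ring
  · rw [S_of_half_le h.le h1, S_of_le_half (by linarith) (by linarith)]; ring

/-- **RIGHT ONE-SIDED DIFFERENCES AT THE INTEGERS ARE SECOND ORDER**: `|Φ(j + h) − Φ(j)| ≤ 2h²` for `j ∈ ℤ`, `0 ≤ h ≤ 1`. [folklore] -/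
theorem abs_Phi_int_add_sub_le (j : ℤ) {h : ℝ} (h0 : 0 ≤ h) (h1 : h ≤ 1) : |Phi ((j : ℝ) + h) - Phi j| ≤ 2 * h ^ 2 := by
  have hS0 : 0 ≤ S h := (S_mem_Icc h).1
  have hS2 : S h ≤ 2 * h ^ 2 := S_le_two_sq h0 h1
  have hpos : 0 ≤ 2 * h ^ 2 := by positivity
  rcases le_or_gt j (-1) with hj | hj
  · have hj' : (j : ℝ) ≤ -1 := by exact_mod_cast hj
    rw [Phi_of_nonpos (by linarith), Phi_of_nonpos (by linarith), sub_zero, abs_zero]; exact hpos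
  · rcases (show j = 0 ∨ j = 1 ∨ j = 2 ∨ 3 ≤ j by omega) with rfl | rfl | rfl | hj3
    · push_cast
      rw [zero_add, Phi_of_nonpos le_rfl, sub_zero, Phi, S_of_nonpos (by linarith : h - 2 ≤ 0), sub_zero, abs_of_nonneg hS0]
      exact hS2
    · push_cast
      rw [Phi_of_mem_plateau (by linarith) (by linarith), Phi_of_mem_plateau le_rfl (by norm_num), sub_self, abs_zero]; exact hpos
    · push_cast
      rw [Phi_of_mem_plateau (by norm_num) le_rfl, Phi, S_of_one_le (by linarith), show (2 : ℝ) + h - 2 = h by ring,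
        show (1 : ℝ) - S h - 1 = -S h by ring, abs_neg, abs_of_nonneg hS0]
      exact hS2
    · have hj' : (3 : ℝ) ≤ j := by exact_mod_cast hj3
      rw [Phi_of_three_le (by linarith), Phi_of_three_le hj', sub_zero, abs_zero]; exact hpos

/-- **LEFT ONE-SIDED DIFFERENCES NEXT TO THE INTEGERS ARE SECOND ORDER**: `|Φ(j − h) − Φ(j − 2h)| ≤ 8h²` for `j ∈ ℤ`, `0 ≤ 2h ≤ 1`. [folklore] -/
theorem abs_Phi_int_sub_sub_le (j : ℤ) {h : ℝ} (h0 : 0 ≤ h) (h1 : 2 * h ≤ 1) :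
    |Phi ((j : ℝ) - h) - Phi ((j : ℝ) - 2 * h)| ≤ 8 * h ^ 2 := by
  have hS0 : 0 ≤ S h := (S_mem_Icc h).1
  have hS0' : 0 ≤ S (2 * h) := (S_mem_Icc (2 * h)).1
  have hS2 : S (2 * h) ≤ 8 * h ^ 2 := by
    have := S_le_two_sq (t := 2 * h) (by positivity) h1; nlinarith
  have hmono : S h ≤ S (2 * h) := by
    have := (S_sub_S_of_le h0 (by linarith : h ≤ 2 * h) h1).1; linarith
  have hpos : 0 ≤ 8 * h ^ 2 := by positivity
  have key : |S (2 * h) - S h| ≤ 8 * h ^ 2 := by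
    rw [abs_of_nonneg (by linarith)]; linarith
  have e1 : S (1 - h) = 1 - S h := by have := S_add_S_one_sub h0 (by linarith); linarith
  have e2 : S (1 - 2 * h) = 1 - S (2 * h) := by have := S_add_S_one_sub (t := 2 * h) (by positivity) h1; linarith
  rcases le_or_gt j 0 with hj | hj
  · have hj' : (j : ℝ) ≤ 0 := by exact_mod_cast hj
    rw [Phi_of_nonpos (by linarith), Phi_of_nonpos (by linarith), sub_zero, abs_zero]; exact hpos
  · rcases (show j = 1 ∨ j = 2 ∨ j = 3 ∨ 4 ≤ j by omega) with rfl | rfl | rfl | hj4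
    · push_cast
      rw [Phi, Phi, S_of_nonpos (by linarith : (1 : ℝ) - h - 2 ≤ 0), S_of_nonpos (by linarith : (1 : ℝ) - 2 * h - 2 ≤ 0), e1, e2]
      rw [show (1 : ℝ) - S h - 0 - (1 - S (2 * h) - 0) = S (2 * h) - S h by ring]
      exact key
    · push_cast
      rw [Phi_of_mem_plateau (by linarith) (by linarith), Phi_of_mem_plateau (by linarith) (by linarith), sub_self, abs_zero]
      exact hpos
    · push_cast
      rw [Phi, Phi, S_of_one_le (show (1 : ℝ) ≤ 3 - h by linarith), S_of_one_le (show (1 : ℝ) ≤ 3 - 2 * h by linarith),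
        show (3 : ℝ) - h - 2 = 1 - h by ring, show (3 : ℝ) - 2 * h - 2 = 1 - 2 * h by ring, e1, e2,
        show (1 : ℝ) - (1 - S h) - (1 - (1 - S (2 * h))) = -(S (2 * h) - S h) by ring, abs_neg]
      exact key
    · have hj' : (4 : ℝ) ≤ j := by exact_mod_cast hj4
      rw [Phi_of_three_le (by linarith), Phi_of_three_le (by linarith), sub_zero, abs_zero]; exact hpos

/-! ### §2 Regions: unions of big blocks inside the bounding box -/

/-- **THE REGION OVER A CELL SET**: the sites of the bounding box `Π_μ[0,(2K_μ+1)W)` whose `W`-block («big block», «cell») lies in `C`.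
[cite: Balaban1983RegularityDecay, p.572 «operators on subsets of the lattice ηZ^d … Ω», dictionary «Ω a union of big blocks»] [folklore] -/
def reg (W : ℕ) (K : Fin (d + 1) → ℕ) (C : Finset (Fin (d + 1) → ℤ)) : Finset (Fin (d + 1) → ℤ) :=
  (boxDom fun μ => (2 * K μ + 1) * W).filter fun x => blk W x ∈ C

/-- membership in a region. [folklore] -/
theorem mem_reg {W : ℕ} {K : Fin (d + 1) → ℕ} {C : Finset (Fin (d + 1) → ℤ)} {x : Fin (d + 1) → ℤ} :
    x ∈ reg W K C ↔ x ∈ boxDom (fun μ => (2 * K μ + 1) * W) ∧ blk W x ∈ C := by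
  simp [reg]

/-- a region lies in its bounding box. [folklore] -/
theorem reg_subset (W : ℕ) (K : Fin (d + 1) → ℕ) (C : Finset (Fin (d + 1) → ℤ)) :
    reg W K C ⊆ boxDom (fun μ => (2 * K μ + 1) * W) :=
  Finset.filter_subset _ _

/-- nested block labels: `blk M (blk n x) = blk (Mn) x`. [folklore] -/
theorem blk_blk_mul (M n : ℕ) (x : Fin (d + 1) → ℤ) : blk M (blk n x) = blk (M * n) x := by
  funext i
  simp only [blk]
  push_cast
  rw [mul_comm, Int.ediv_ediv_of_nonneg (by positivity)]

/-- the bounding box with `W = Mn` is a union of `n`-blocks (it is `NE7K1LinWalkFineOp.boxR n M K`). [folklore] -/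
theorem box_isBlockUnion_fine {n : ℕ} (hn : 1 ≤ n) (M : ℕ) (K : Fin (d + 1) → ℕ) :
    IsBlockUnion n (boxDom fun μ : Fin (d + 1) => (2 * K μ + 1) * (M * n)) :=
  boxR_isBlockUnion hn M K

/-- **A REGION IS A UNION OF BIG BLOCKS** (`W`-blocks, `W ≥ 1`). [folklore] -/
theorem reg_isBlockUnion {W : ℕ} (hW : 1 ≤ W) (K : Fin (d + 1) → ℕ) (C : Finset (Fin (d + 1) → ℤ)) :
    IsBlockUnion W (reg W K C) := by
  intro x hx z hz
  rw [mem_reg] at hx ⊢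
  have hbox : IsBlockUnion W (boxDom fun μ : Fin (d + 1) => (2 * K μ + 1) * W) := by
    have e : (fun μ : Fin (d + 1) => (2 * K μ + 1) * W) = fun μ => W * (2 * K μ + 1) := funext fun μ => by ring
    rw [e]; exact boxDom_isBlockUnion hW _
  exact ⟨hbox hx.1 hz, hz ▸ hx.2⟩

/-- with `W = Mn` a region is a union of `n`-blocks — the hypothesis of `B4Lower18.lower18_zero`. [folklore] -/
theorem reg_isBlockUnion_fine {n : ℕ} (hn : 1 ≤ n) (M : ℕ) (K : Fin (d + 1) → ℕ) (C : Finset (Fin (d + 1) → ℤ)) :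
    IsBlockUnion n (reg (M * n) K C) := by
  intro x hx z hz
  rw [mem_reg] at hx ⊢
  refine ⟨box_isBlockUnion_fine hn M K hx.1 hz, ?_⟩
  rw [← blk_blk_mul, hz, blk_blk_mul]; exact hx.2

/-- **EVERY UNION OF BIG BLOCKS IN THE BOUNDING BOX IS A REGION**: `R = reg W K (R.image (blk W))`. [folklore] -/
theorem reg_image_blk_eq {W : ℕ} {K : Fin (d + 1) → ℕ} {R : Finset (Fin (d + 1) → ℤ)} (hR : IsBlockUnion W R)
    (hRbox : R ⊆ boxDom (fun μ => (2 * K μ + 1) * W)) : reg W K (R.image (blk W)) = R := by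
  ext x
  rw [mem_reg, Finset.mem_image]
  constructor
  · rintro ⟨-, y, hy, hyx⟩
    exact hR hy hyx.symm
  · intro hx
    exact ⟨hRbox hx, x, hx, rfl⟩

/-- the aligned box itself is the region of all its cells. [folklore] -/
theorem reg_box (W : ℕ) (K : Fin (d + 1) → ℕ) :
    reg W K ((boxDom fun μ => (2 * K μ + 1) * W).image (blk W)) = boxDom (fun μ => (2 * K μ + 1) * W) := by
  ext x
  rw [mem_reg, Finset.mem_image]
  constructor
  · exact fun h => h.1
  · exact fun hx => ⟨hx, x, hx, rfl⟩

/-- the partition of unity `Σ_{J ∈ Π_μ{0..K_μ}} cut W J x = 1` holds on every region (it holds on the bounding box). [folklore] -/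
theorem sum_cut_eq_one_region {W : ℕ} (hW : 1 ≤ W) (K : Fin (d + 1) → ℕ) (C : Finset (Fin (d + 1) → ℤ)) {x : Fin (d + 1) → ℤ}
    (hx : x ∈ reg W K C) : ∑ J ∈ Fintype.piFinset (fun μ => Finset.range (K μ + 1)), cut W J x = 1 :=
  sum_cut_eq_one hW K (reg_subset W K C hx)

/-! ### §3 Faces of a region sit on the cell lattice -/

/-- integer division: if `(a+1)∕W ≠ a∕W` (`W ≥ 1`) then `W ∣ a + 1`. [folklore] -/
theorem exists_mul_of_ediv_succ_ne {W : ℕ} (hW : 1 ≤ W) {a : ℤ} (h : (a + 1) / (W : ℤ) ≠ a / (W : ℤ)) :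
    ∃ m : ℤ, a + 1 = m * W := by
  have hW0 : (0 : ℤ) < W := by exact_mod_cast hW
  have hr0 : 0 ≤ a % (W : ℤ) := Int.emod_nonneg _ (ne_of_gt hW0)
  have hrW : a % (W : ℤ) < W := Int.emod_lt_of_pos _ hW0
  have hdec : a % (W : ℤ) + (W : ℤ) * (a / (W : ℤ)) = a := Int.emod_add_mul_ediv a W
  by_cases hlt : a % (W : ℤ) + 1 < W
  · exfalso
    apply h
    exact ((Int.ediv_emod_unique hW0).2 ⟨by linarith, by linarith, hlt⟩).1
  · refine ⟨a / (W : ℤ) + 1, ?_⟩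
    have : a % (W : ℤ) + 1 = W := by omega
    linarith

/-- **A MISSING UPPER NEIGHBOUR SITS AT A CELL BOUNDARY**: `x ∈ Ω`, `x + e_μ ∉ Ω ⇒ W ∣ x_μ + 1`. [folklore] -/
theorem exists_mul_of_add_uvec_not_mem {W : ℕ} (hW : 1 ≤ W) {K : Fin (d + 1) → ℕ} {C : Finset (Fin (d + 1) → ℤ)}
    {x : Fin (d + 1) → ℤ} (hx : x ∈ reg W K C) {μ : Fin (d + 1)} (h : x + uvec μ ∉ reg W K C) :
    ∃ m : ℤ, x μ + 1 = m * W := by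
  rw [mem_reg] at hx
  by_cases hb : blk W (x + uvec μ) = blk W x
  · -- same cell: then `x + e_μ` left the bounding box through the top face
    have hnot : x + uvec μ ∉ boxDom (fun μ => (2 * K μ + 1) * W) := fun hin => h (mem_reg.2 ⟨hin, hb ▸ hx.2⟩)
    have e1 : x + uvec μ = x + (1 : ℤ) • uvec μ := by simp
    rw [e1, add_smul_uvec_mem_boxDom hx.1] at hnot
    have hxμ := (mem_boxDom.1 hx.1) μ
    refine ⟨2 * K μ + 1, ?_⟩
    push_cast at hxμ hnot ⊢
    omega
  · -- the cell changes across the bond: only the `μ`-th label can move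
    have hμ : (x μ + 1) / (W : ℤ) ≠ x μ / (W : ℤ) := by
      intro hq; apply hb; funext i
      by_cases hi : i = μ
      · subst hi; simpa [blk, uvec_apply_same] using hq
      · simp [blk, uvec_apply_ne hi]
    exact exists_mul_of_ediv_succ_ne hW hμ

/-- **A MISSING LOWER NEIGHBOUR SITS AT A CELL BOUNDARY**: `x ∈ Ω`, `x − e_μ ∉ Ω ⇒ W ∣ x_μ`. [folklore] -/
theorem exists_mul_of_sub_uvec_not_mem {W : ℕ} (hW : 1 ≤ W) {K : Fin (d + 1) → ℕ} {C : Finset (Fin (d + 1) → ℤ)}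
    {x : Fin (d + 1) → ℤ} (hx : x ∈ reg W K C) {μ : Fin (d + 1)} (h : x - uvec μ ∉ reg W K C) :
    ∃ m : ℤ, x μ = m * W := by
  rw [mem_reg] at hx
  by_cases hb : blk W (x - uvec μ) = blk W x
  · have hnot : x - uvec μ ∉ boxDom (fun μ => (2 * K μ + 1) * W) := fun hin => h (mem_reg.2 ⟨hin, hb ▸ hx.2⟩)
    have e2 : x - uvec μ = x + (-1 : ℤ) • uvec μ := by simp [sub_eq_add_neg]
    rw [e2, add_smul_uvec_mem_boxDom hx.1] at hnot
    have hxμ := (mem_boxDom.1 hx.1) μ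
    refine ⟨0, ?_⟩
    omega
  · have hμ : (x μ - 1 + 1) / (W : ℤ) ≠ (x μ - 1) / (W : ℤ) := by
      intro hq; apply hb; funext i
      by_cases hi : i = μ
      · subst hi
        rw [sub_add_cancel] at hq
        simpa [blk, uvec_apply_same] using hq.symm
      · simp [blk, uvec_apply_ne hi]
    obtain ⟨m, hm⟩ := exists_mul_of_ediv_succ_ne hW hμ
    exact ⟨m, by linarith⟩

/-! ### §4 The Neumann second difference of a cut-off on a region -/

/-- **ONE-SIDED DIFFERENCE AT A LOWER CELL FACE**: `W ∣ x_μ ⇒ |cut x − cut(x + e_μ)| ≤ 2∕W²` (`W ≥ 1`). [folklore] -/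
theorem abs_cut_sub_cut_add_uvec_le {W : ℕ} (hW : 1 ≤ W) (J : Fin (d + 1) → ℕ) {x : Fin (d + 1) → ℤ} {μ : Fin (d + 1)}
    (hx : ∃ m : ℤ, x μ = m * W) : |cut W J x - cut W J (x + uvec μ)| ≤ 2 / (W : ℝ) ^ 2 := by
  obtain ⟨m, hm⟩ := hx
  have hW0 : (0 : ℝ) < W := by exact_mod_cast hW
  have hW1 : 1 / (W : ℝ) ≤ 1 := by rw [div_le_one hW0]; exact_mod_cast hW
  have e1 : x + uvec μ = x + (1 : ℤ) • uvec μ := by simp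
  rw [cut_eq_mul_prod_erase W J (x + uvec μ) μ, cut_eq_mul_prod_erase W J x μ, e1, prod_erase_arg_add_smul_uvec,
    arg_add_smul_uvec]
  set R := ∏ ν ∈ univ.erase μ, Phi (arg W J x ν)
  have ht : arg W J x μ = ((m - 2 * (J μ : ℤ) + 1 : ℤ) : ℝ) := by
    simp only [arg, hm]; push_cast; field_simp
  rw [ht, show Phi ((m - 2 * (J μ : ℤ) + 1 : ℤ) : ℝ) * R - Phi (((m - 2 * (J μ : ℤ) + 1 : ℤ) : ℝ) + ((1 : ℤ) : ℝ) / W) * R =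
    -((Phi (((m - 2 * (J μ : ℤ) + 1 : ℤ) : ℝ) + 1 / W) - Phi ((m - 2 * (J μ : ℤ) + 1 : ℤ) : ℝ)) * R) by push_cast; ring,
    abs_neg, abs_mul]
  calc |Phi (((m - 2 * (J μ : ℤ) + 1 : ℤ) : ℝ) + 1 / W) - Phi ((m - 2 * (J μ : ℤ) + 1 : ℤ) : ℝ)| * |R|
      ≤ 2 * (1 / (W : ℝ)) ^ 2 * 1 :=
        mul_le_mul (abs_Phi_int_add_sub_le _ (by positivity) hW1) (abs_prod_erase_le_one W J x μ) (abs_nonneg _) (by positivity)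
    _ = 2 / (W : ℝ) ^ 2 := by ring

/-- **ONE-SIDED DIFFERENCE AT AN UPPER CELL FACE**: `W ∣ x_μ + 1 ⇒ |cut x − cut(x − e_μ)| ≤ 8∕W²` (`W ≥ 2`). [folklore] -/
theorem abs_cut_sub_cut_sub_uvec_le {W : ℕ} (hW : 2 ≤ W) (J : Fin (d + 1) → ℕ) {x : Fin (d + 1) → ℤ} {μ : Fin (d + 1)}
    (hx : ∃ m : ℤ, x μ + 1 = m * W) : |cut W J x - cut W J (x - uvec μ)| ≤ 8 / (W : ℝ) ^ 2 := by
  obtain ⟨m, hm⟩ := hx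
  have hW0 : (0 : ℝ) < W := by positivity
  have hW2 : 2 * (1 / (W : ℝ)) ≤ 1 := by rw [mul_one_div, div_le_one hW0]; exact_mod_cast hW
  have e2 : x - uvec μ = x + (-1 : ℤ) • uvec μ := by simp [sub_eq_add_neg]
  rw [cut_eq_mul_prod_erase W J (x - uvec μ) μ, cut_eq_mul_prod_erase W J x μ, e2, prod_erase_arg_add_smul_uvec,
    arg_add_smul_uvec]
  set R := ∏ ν ∈ univ.erase μ, Phi (arg W J x ν)
  have hxμ : (x μ : ℝ) = m * W - 1 := by
    have : x μ = m * W - 1 := by linarith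
    rw [this]; push_cast; ring
  have ht : arg W J x μ = ((m - 2 * (J μ : ℤ) + 1 : ℤ) : ℝ) - 1 / W := by
    simp only [arg, hxμ]; push_cast; field_simp; ring
  have ht' : arg W J x μ + ((-1 : ℤ) : ℝ) / W = ((m - 2 * (J μ : ℤ) + 1 : ℤ) : ℝ) - 2 * (1 / W) := by rw [ht]; push_cast; ring
  rw [ht', ht, ← sub_mul, abs_mul]
  calc |Phi (((m - 2 * (J μ : ℤ) + 1 : ℤ) : ℝ) - 1 / W) - Phi (((m - 2 * (J μ : ℤ) + 1 : ℤ) : ℝ) - 2 * (1 / W))| * |R|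
      ≤ 8 * (1 / (W : ℝ)) ^ 2 * 1 :=
        mul_le_mul (abs_Phi_int_sub_sub_le _ (by positivity) hW2) (abs_prod_erase_le_one W J x μ) (abs_nonneg _) (by positivity)
    _ = 8 / (W : ℝ) ^ 2 := by ring

/-- **THE NEUMANN SECOND DIFFERENCE IS `O(W^{−2})` AT EVERY SITE OF EVERY REGION** (`W ≥ 2`): interior sites carry a full second
difference (`≤ 32∕W²`), sites with one missing neighbour a one-sided difference at a cell face (`≤ 8∕W²`), isolated sites nothing.
[cite: Balaban1983RegularityDecay, p.575 «|Δh_j| = O(M⁻²)», dictionary incl. ∂Ω for Ω a union of big blocks] [folklore] -/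
theorem abs_dirDiff_le_region {W : ℕ} (hW : 2 ≤ W) (K : Fin (d + 1) → ℕ) (C : Finset (Fin (d + 1) → ℤ)) (J : Fin (d + 1) → ℕ)
    {x : Fin (d + 1) → ℤ} (hx : x ∈ reg W K C) (μ : Fin (d + 1)) :
    |(if x + uvec μ ∈ reg W K C then cut W J x - cut W J (x + uvec μ) else 0) +
        (if x - uvec μ ∈ reg W K C then cut W J x - cut W J (x - uvec μ) else 0)| ≤ 32 / (W : ℝ) ^ 2 := by
  have hW1 : 1 ≤ W := le_trans (by norm_num) hW
  have hpos : (0 : ℝ) ≤ 32 / (W : ℝ) ^ 2 := by positivity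
  by_cases hup : x + uvec μ ∈ reg W K C
  · rw [if_pos hup]
    by_cases hdn : x - uvec μ ∈ reg W K C
    · rw [if_pos hdn]
      have := abs_cut_secondDiff_le hW1 J x μ
      rw [abs_sub_comm] at this
      refine le_trans (le_of_eq ?_) this
      congr 1; ring
    · rw [if_neg hdn, add_zero]
      exact (abs_cut_sub_cut_add_uvec_le hW1 J (exists_mul_of_sub_uvec_not_mem hW1 hx hdn)).trans
        (by gcongr; norm_num)
  · rw [if_neg hup, zero_add]
    by_cases hdn : x - uvec μ ∈ reg W K C
    · rw [if_pos hdn]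
      exact (abs_cut_sub_cut_sub_uvec_le hW J (exists_mul_of_add_uvec_not_mem hW1 hx hup)).trans (by gcongr; norm_num)
    · rw [if_neg hdn, abs_zero]; exact hpos

/-- **THE NEUMANN SECOND DIFFERENCE OF THE CUT-OFF, SUMMED OVER THE NEIGHBOURS PRESENT IN A REGION, IS `O(W^{−2})`**:
`|Σ_{y ∼ x, y ∈ Ω}(cut x − cut y)| ≤ 32(d+1)∕W²` for EVERY region `Ω = reg W K C` (every union of big blocks), `W ≥ 2` — the hypothesis
`hlap` of `NE7K1LinWalkCommutator.comm_mulVec_sq_le_fineOpR`, with the same constant as on the aligned box.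
[cite: Balaban1983RegularityDecay, p.575 «|Δh_j| = O(M⁻²)», dictionary] [folklore] -/
theorem abs_sum_nbrs_cut_sub_le_region {W : ℕ} (hW : 2 ≤ W) (K : Fin (d + 1) → ℕ) (C : Finset (Fin (d + 1) → ℤ))
    (J : Fin (d + 1) → ℕ) (x : ↥(reg W K C)) :
    |∑ y ∈ univ.filter (fun y : ↥(reg W K C) => y.1 ∈ nbrs x.1), (cut W J x.1 - cut W J y.1)| ≤
      32 * ((d : ℝ) + 1) / (W : ℝ) ^ 2 := by
  rw [sum_filter_nbrs_eq_sum_dir]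
  refine (Finset.abs_sum_le_sum_abs _ _).trans ?_
  refine (Finset.sum_le_sum fun μ _ => abs_dirDiff_le_region hW K C J x.2 μ).trans (le_of_eq ?_)
  rw [Finset.sum_const, Finset.card_univ, Fintype.card_fin, nsmul_eq_mul]; push_cast; ring

end Summit.QuantumFields.BalabanUV.T4Continuum.NE7K1LinWalkRegion

end
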